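import Summits.NavierStokesRegularity.OSWSelfSimilar.SheetRWeakToStrong
import HarnessLib

/-!
# SHEET-ℝ weak→classical bridge, assembly step (δ): the weak pairing of `Ω̄ + δ` splits as residual + linearisation + quadratic part

HONEST FRAMING (cell ns-blowup GROUP B / zone Z3, case Z3-SR-CERT; 1-D MODEL (viscous gCLM/OSW on the line); not Euler/NS;
«violates: none — MODEL»). Nothing here asserts that a profile exists.

The certificate delivers its profile as `Ω* = Ω̄ + δ*` with `δ*` the fixed point of `δ ↦ −S(G(Ω̄) + Qδδ)`
(`CertificateViscousSheetR.existsUnique_fixedPoint_of_row(_w)`), i.e. — read weakly — `⟨DG(Ω̄)δ*, ψ⟩ = −⟨G(Ω̄), ψ⟩ − ⟨Qδ*δ*, ψ⟩` for the test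
functions `ψ`.  The bridge (`SheetRWeakToStrong`, `SheetRWeakZeroParityAE`) consumes the weak profile equation (W) for `Ω*` itself.  This file is the
algebra in between, at FUNCTION level and for GENERAL `H¹`-type data: for `Ω̄ = Ω̄(0) + ∫₀Ω̄₁` and `δ = δ(0) + ∫₀δ₁` (`Ω̄₁, δ₁ ∈ L²`, `Ω̄, δ ∈ L¹ ∩ L²`)
the p.v. Hilbert transform and the velocity are additive POINTWISE (`hilbertTransform_add_of_primitive`, `velocity_add_of_primitive`), the right-hand side
splits pointwise as `F(Ω̄ + δ) = F(Ω̄) + L_Ω̄ δ + Q δ` with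
`L_Ω̄ δ = δ + ½ξδ₁ + a(𝒰Ω̄·δ₁ + 𝒰δ·Ω̄₁) − (HΩ̄·δ + Hδ·Ω̄)` and `Qδ = a𝒰δ·δ₁ − Hδ·δ` (`rhs_add_of_primitive`), every piece is locally integrable,
and for every `C_c^∞` test `ψ`:

  `P(Ω̄ + δ)[ψ] = P(Ω̄)[ψ] + (∫ L_Ω̄δ·ψ + ν∫ δ₁ψ′) + ∫ Qδ·ψ`,   `P(Ω)[ψ] := ∫ F(Ω)ψ + ν∫ Ω₁ψ′`   (`weakPairing_add_of_primitive`);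

hence (`weakZero_of_linearised`) if `∫ L_Ω̄δ·ψ + ν∫δ₁ψ′ = −(P(Ω̄)[ψ] + ∫Qδ·ψ)` for all (odd) tests — the weak reading of the fixed-point equation —
then (W) holds for `Ω̄ + δ` against the same tests.  Pure calculus; no definition, no named fact.  WHAT THIS IS NOT: not NS; not the MODEL ASSEMBLY
(which must identify its `S`, `G(Ω̄)`, `Q` with these pairings).
-/

noncomputable section

namespace Summit.NavierStokesRegularity.OSWSelfSimilar
namespace SheetRWeakPairingExpansion

open _root_.MeasureTheory _root_.Set _root_.Filter _root_.Function Literature.Analysis.Fourier Literature.Analysis.FluidPDE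
  SheetRWeakProfilePV SheetRWeakToStrong
open scoped Real Topology ContDiff

/-- Sums of `H¹`-type profiles are `H¹`-type: `Ω̄ + δ = (Ω̄ + δ)(0) + ∫₀(Ω̄₁ + δ₁)`. [folklore] -/
theorem primitive_add {Ω Ω₁ δ δ₁ : ℝ → ℝ} (hΩ : ∀ x, Ω x = Ω 0 + ∫ s in (0 : ℝ)..x, Ω₁ s) (hΩ₁ : MemLp Ω₁ 2)
    (hδ : ∀ x, δ x = δ 0 + ∫ s in (0 : ℝ)..x, δ₁ s) (hδ₁ : MemLp δ₁ 2) (x : ℝ) :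
    (Ω x + δ x) = (Ω 0 + δ 0) + ∫ s in (0 : ℝ)..x, (Ω₁ s + δ₁ s) := by
  rw [intervalIntegral.integral_add (intervalIntegrable_of_memLp_two hΩ₁ 0 x) (intervalIntegrable_of_memLp_two hδ₁ 0 x), hΩ x, hδ x]
  ring

/-- **Pointwise additivity of the p.v. Hilbert transform on `H¹`-type `L¹` profiles** (both symmetric integrands are integrable at every point).
[folklore] -/
theorem hilbertTransform_add_of_primitive {Ω Ω₁ δ δ₁ : ℝ → ℝ} (hΩ : ∀ x, Ω x = Ω 0 + ∫ s in (0 : ℝ)..x, Ω₁ s) (hΩ₁ : MemLp Ω₁ 2)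
    (hΩi : Integrable Ω) (hδ : ∀ x, δ x = δ 0 + ∫ s in (0 : ℝ)..x, δ₁ s) (hδ₁ : MemLp δ₁ 2) (hδi : Integrable δ) (x : ℝ) :
    hilbertTransform (fun y => Ω y + δ y) x = hilbertTransform Ω x + hilbertTransform δ x :=
  hilbertTransform_add (integrableOn_symmIntegrand_of_primitive hΩ hΩ₁ hΩi x) (integrableOn_symmIntegrand_of_primitive hδ hδ₁ hδi x)

/-- … and of the velocity `𝒰 = ∫₀ H`. [folklore] -/
theorem velocity_add_of_primitive {Ω Ω₁ δ δ₁ : ℝ → ℝ} (hΩ : ∀ x, Ω x = Ω 0 + ∫ s in (0 : ℝ)..x, Ω₁ s) (hΩ₁ : MemLp Ω₁ 2)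
    (hΩi : Integrable Ω) (hΩ2 : MemLp Ω 2) (hδ : ∀ x, δ x = δ 0 + ∫ s in (0 : ℝ)..x, δ₁ s) (hδ₁ : MemLp δ₁ 2) (hδi : Integrable δ)
    (hδ2 : MemLp δ 2) (x : ℝ) :
    ∫ s in (0 : ℝ)..x, hilbertTransform (fun y => Ω y + δ y) s
      = (∫ s in (0 : ℝ)..x, hilbertTransform Ω s) + ∫ s in (0 : ℝ)..x, hilbertTransform δ s := by
  rw [← intervalIntegral.integral_add (intervalIntegrable_hilbertTransform_of_primitive hΩ hΩ₁ hΩi hΩ2 0 x)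
    (intervalIntegrable_hilbertTransform_of_primitive hδ hδ₁ hδi hδ2 0 x)]
  exact intervalIntegral.integral_congr fun s _ => hilbertTransform_add_of_primitive hΩ hΩ₁ hΩi hδ hδ₁ hδi s

/-- **Pointwise splitting of the right-hand side**: `F(Ω̄ + δ) = F(Ω̄) + L_Ω̄δ + Qδ`. [folklore] -/
theorem rhs_add_of_primitive {a : ℝ} {Ω Ω₁ δ δ₁ : ℝ → ℝ} (hΩ : ∀ x, Ω x = Ω 0 + ∫ s in (0 : ℝ)..x, Ω₁ s) (hΩ₁ : MemLp Ω₁ 2)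
    (hΩi : Integrable Ω) (hΩ2 : MemLp Ω 2) (hδ : ∀ x, δ x = δ 0 + ∫ s in (0 : ℝ)..x, δ₁ s) (hδ₁ : MemLp δ₁ 2) (hδi : Integrable δ)
    (hδ2 : MemLp δ 2) (x : ℝ) :
    (Ω x + δ x) + 1 / 2 * x * (Ω₁ x + δ₁ x)
        + a * (∫ s in (0 : ℝ)..x, hilbertTransform (fun y => Ω y + δ y) s) * (Ω₁ x + δ₁ x)
        - hilbertTransform (fun y => Ω y + δ y) x * (Ω x + δ x)
      = (Ω x + 1 / 2 * x * Ω₁ x + a * (∫ s in (0 : ℝ)..x, hilbertTransform Ω s) * Ω₁ x - hilbertTransform Ω x * Ω x)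
        + (δ x + 1 / 2 * x * δ₁ x
            + a * ((∫ s in (0 : ℝ)..x, hilbertTransform Ω s) * δ₁ x + (∫ s in (0 : ℝ)..x, hilbertTransform δ s) * Ω₁ x)
            - (hilbertTransform Ω x * δ x + hilbertTransform δ x * Ω x))
        + (a * (∫ s in (0 : ℝ)..x, hilbertTransform δ s) * δ₁ x - hilbertTransform δ x * δ x) := by
  rw [velocity_add_of_primitive hΩ hΩ₁ hΩi hΩ2 hδ hδ₁ hδi hδ2, hilbertTransform_add_of_primitive hΩ hΩ₁ hΩi hδ hδ₁ hδi]
  ring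

/-- The quadratic part `Qδ = a𝒰δ·δ₁ − Hδ·δ` and the linearisation `L_Ω̄δ` are locally integrable. [folklore] -/
theorem locallyIntegrable_quadratic_and_linear {a : ℝ} {Ω Ω₁ δ δ₁ : ℝ → ℝ} (hΩ : ∀ x, Ω x = Ω 0 + ∫ s in (0 : ℝ)..x, Ω₁ s)
    (hΩ₁ : MemLp Ω₁ 2) (hΩi : Integrable Ω) (hΩ2 : MemLp Ω 2) (hδ : ∀ x, δ x = δ 0 + ∫ s in (0 : ℝ)..x, δ₁ s) (hδ₁ : MemLp δ₁ 2)
    (hδi : Integrable δ) (hδ2 : MemLp δ 2) :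
    LocallyIntegrable (fun x => a * (∫ s in (0 : ℝ)..x, hilbertTransform δ s) * δ₁ x - hilbertTransform δ x * δ x) ∧
    LocallyIntegrable (fun x => δ x + 1 / 2 * x * δ₁ x
      + a * ((∫ s in (0 : ℝ)..x, hilbertTransform Ω s) * δ₁ x + (∫ s in (0 : ℝ)..x, hilbertTransform δ s) * Ω₁ x)
      - (hilbertTransform Ω x * δ x + hilbertTransform δ x * Ω x)) := by
  have hδc : Continuous δ := continuous_of_primitive hδ (intervalIntegrable_of_memLp_two hδ₁)
  have hδ₁loc : LocallyIntegrable δ₁ := hδ₁.locallyIntegrable one_le_two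
  have hFδ := locallyIntegrable_rhs (a := a) hδ hδ₁ hδi hδ2
  -- Qδ = F(δ) − δ − ½ξδ₁
  have h1 : LocallyIntegrable fun x => 1 / 2 * x * δ₁ x := by
    have := hδ₁loc
    rw [← locallyIntegrableOn_univ] at this ⊢
    exact this.continuousOn_mul (continuous_const.mul continuous_id).continuousOn isClosed_univ.isLocallyClosed
  have hQ : LocallyIntegrable (fun x => a * (∫ s in (0 : ℝ)..x, hilbertTransform δ s) * δ₁ x - hilbertTransform δ x * δ x) := by
    refine ((hFδ.sub hδc.locallyIntegrable).sub h1).congr ?_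
    exact Eventually.of_forall fun x => by simp only [Pi.sub_apply]; ring
  refine ⟨hQ, ?_⟩
  -- Lδ = F(Ω̄+δ) − F(Ω̄) − Qδ
  have hsum : ∀ x, (Ω x + δ x) = (Ω 0 + δ 0) + ∫ s in (0 : ℝ)..x, (Ω₁ s + δ₁ s) := primitive_add hΩ hΩ₁ hδ hδ₁
  have hsum' : ∀ x, (fun y => Ω y + δ y) x = (fun y => Ω y + δ y) 0 + ∫ s in (0 : ℝ)..x, (fun y => Ω₁ y + δ₁ y) s :=
    fun x => by simp only; exact hsum x
  have hFsum := locallyIntegrable_rhs (a := a) hsum' (hΩ₁.add hδ₁) (hΩi.add hδi) (hΩ2.add hδ2)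
  have hFΩ := locallyIntegrable_rhs (a := a) hΩ hΩ₁ hΩi hΩ2
  refine ((hFsum.sub hFΩ).sub hQ).congr (Eventually.of_forall fun x => ?_)
  simp only [Pi.sub_apply]
  rw [rhs_add_of_primitive hΩ hΩ₁ hΩi hΩ2 hδ hδ₁ hδi hδ2 x]
  ring

/-- **The weak pairing of `Ω̄ + δ` splits**: for every `C_c^∞` test `ψ`,
`P(Ω̄+δ)[ψ] = P(Ω̄)[ψ] + (∫ L_Ω̄δ·ψ + ν∫δ₁ψ′) + ∫ Qδ·ψ`, `P(Ω)[ψ] = ∫ F(Ω)ψ + ν∫Ω₁ψ′`. [folklore] -/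
theorem weakPairing_add_of_primitive {a ν : ℝ} {Ω Ω₁ δ δ₁ : ℝ → ℝ} (hΩ : ∀ x, Ω x = Ω 0 + ∫ s in (0 : ℝ)..x, Ω₁ s)
    (hΩ₁ : MemLp Ω₁ 2) (hΩi : Integrable Ω) (hΩ2 : MemLp Ω 2) (hδ : ∀ x, δ x = δ 0 + ∫ s in (0 : ℝ)..x, δ₁ s) (hδ₁ : MemLp δ₁ 2)
    (hδi : Integrable δ) (hδ2 : MemLp δ 2) {ψ : ℝ → ℝ} (hψ : ContDiff ℝ ∞ ψ) (hψc : HasCompactSupport ψ) :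
    (∫ x, ((Ω x + δ x) + 1 / 2 * x * (Ω₁ x + δ₁ x)
        + a * (∫ s in (0 : ℝ)..x, hilbertTransform (fun y => Ω y + δ y) s) * (Ω₁ x + δ₁ x)
        - hilbertTransform (fun y => Ω y + δ y) x * (Ω x + δ x)) * ψ x) + ν * ∫ x, (Ω₁ x + δ₁ x) * deriv ψ x
      = ((∫ x, (Ω x + 1 / 2 * x * Ω₁ x + a * (∫ s in (0 : ℝ)..x, hilbertTransform Ω s) * Ω₁ x
            - hilbertTransform Ω x * Ω x) * ψ x) + ν * ∫ x, Ω₁ x * deriv ψ x)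
        + ((∫ x, (δ x + 1 / 2 * x * δ₁ x
              + a * ((∫ s in (0 : ℝ)..x, hilbertTransform Ω s) * δ₁ x + (∫ s in (0 : ℝ)..x, hilbertTransform δ s) * Ω₁ x)
              - (hilbertTransform Ω x * δ x + hilbertTransform δ x * Ω x)) * ψ x) + ν * ∫ x, δ₁ x * deriv ψ x)
        + ∫ x, (a * (∫ s in (0 : ℝ)..x, hilbertTransform δ s) * δ₁ x - hilbertTransform δ x * δ x) * ψ x := by
  obtain ⟨hQ, hL⟩ := locallyIntegrable_quadratic_and_linear (a := a) hΩ hΩ₁ hΩi hΩ2 hδ hδ₁ hδi hδ2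
  have hFΩ := locallyIntegrable_rhs (a := a) hΩ hΩ₁ hΩi hΩ2
  have hψc' : Continuous ψ := hψ.continuous
  have hdc : Continuous (deriv ψ) := hψ.continuous_deriv (by exact_mod_cast le_top)
  have hdcs : HasCompactSupport (deriv ψ) := hψc.deriv
  have hi : ∀ {g : ℝ → ℝ}, LocallyIntegrable g → Integrable fun x => g x * ψ x := fun hg => by
    simpa only [smul_eq_mul] using hg.integrable_smul_right_of_hasCompactSupport hψc' hψc
  have hi' : ∀ {g : ℝ → ℝ}, LocallyIntegrable g → Integrable fun x => g x * deriv ψ x := fun hg => by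
    simpa only [smul_eq_mul] using hg.integrable_smul_right_of_hasCompactSupport hdc hdcs
  have hΩ₁loc : LocallyIntegrable Ω₁ := hΩ₁.locallyIntegrable one_le_two
  have hδ₁loc : LocallyIntegrable δ₁ := hδ₁.locallyIntegrable one_le_two
  -- the F-part
  have e1 : ∫ x, ((Ω x + δ x) + 1 / 2 * x * (Ω₁ x + δ₁ x)
        + a * (∫ s in (0 : ℝ)..x, hilbertTransform (fun y => Ω y + δ y) s) * (Ω₁ x + δ₁ x)
        - hilbertTransform (fun y => Ω y + δ y) x * (Ω x + δ x)) * ψ x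
      = (∫ x, (Ω x + 1 / 2 * x * Ω₁ x + a * (∫ s in (0 : ℝ)..x, hilbertTransform Ω s) * Ω₁ x
            - hilbertTransform Ω x * Ω x) * ψ x)
        + (∫ x, (δ x + 1 / 2 * x * δ₁ x
              + a * ((∫ s in (0 : ℝ)..x, hilbertTransform Ω s) * δ₁ x + (∫ s in (0 : ℝ)..x, hilbertTransform δ s) * Ω₁ x)
              - (hilbertTransform Ω x * δ x + hilbertTransform δ x * Ω x)) * ψ x)
        + ∫ x, (a * (∫ s in (0 : ℝ)..x, hilbertTransform δ s) * δ₁ x - hilbertTransform δ x * δ x) * ψ x := by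
    have hFL := (hi hFΩ).add (hi hL)
    simp only [Pi.add_def] at hFL
    rw [← integral_add (hi hFΩ) (hi hL), ← integral_add hFL (hi hQ)]
    refine integral_congr_ae (Eventually.of_forall fun x => ?_)
    beta_reduce
    rw [rhs_add_of_primitive hΩ hΩ₁ hΩi hΩ2 hδ hδ₁ hδi hδ2 x]
    ring
  -- the ν-part
  have e2 : ∫ x, (Ω₁ x + δ₁ x) * deriv ψ x = (∫ x, Ω₁ x * deriv ψ x) + ∫ x, δ₁ x * deriv ψ x := by
    rw [← integral_add (hi' hΩ₁loc) (hi' hδ₁loc)]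
    exact integral_congr_ae (Eventually.of_forall fun x => by simp only [add_mul])
  rw [e1, e2]
  ring

/-- **(W) from the weak reading of the fixed-point equation.** If, against a class of `C_c^∞` tests `ψ` (a predicate `T`, e.g. «odd»), the
linearised pairing of `δ` balances residual plus quadratic part — `∫ L_Ω̄δ·ψ + ν∫δ₁ψ′ = −(P(Ω̄)[ψ] + ∫Qδ·ψ)` — then `Ω̄ + δ` satisfies the weak
profile equation (W) against every test in the class. MODEL bookkeeping. [folklore] -/
theorem weakZero_of_linearised {a ν : ℝ} {Ω Ω₁ δ δ₁ : ℝ → ℝ} {T : (ℝ → ℝ) → Prop}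
    (hΩ : ∀ x, Ω x = Ω 0 + ∫ s in (0 : ℝ)..x, Ω₁ s) (hΩ₁ : MemLp Ω₁ 2) (hΩi : Integrable Ω) (hΩ2 : MemLp Ω 2)
    (hδ : ∀ x, δ x = δ 0 + ∫ s in (0 : ℝ)..x, δ₁ s) (hδ₁ : MemLp δ₁ 2) (hδi : Integrable δ) (hδ2 : MemLp δ 2)
    (hlin : ∀ ψ : ℝ → ℝ, ContDiff ℝ ∞ ψ → HasCompactSupport ψ → T ψ →
      (∫ x, (δ x + 1 / 2 * x * δ₁ x
          + a * ((∫ s in (0 : ℝ)..x, hilbertTransform Ω s) * δ₁ x + (∫ s in (0 : ℝ)..x, hilbertTransform δ s) * Ω₁ x)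
          - (hilbertTransform Ω x * δ x + hilbertTransform δ x * Ω x)) * ψ x) + ν * ∫ x, δ₁ x * deriv ψ x
        = -(((∫ x, (Ω x + 1 / 2 * x * Ω₁ x + a * (∫ s in (0 : ℝ)..x, hilbertTransform Ω s) * Ω₁ x
              - hilbertTransform Ω x * Ω x) * ψ x) + ν * ∫ x, Ω₁ x * deriv ψ x)
            + ∫ x, (a * (∫ s in (0 : ℝ)..x, hilbertTransform δ s) * δ₁ x - hilbertTransform δ x * δ x) * ψ x)) :
    ∀ ψ : ℝ → ℝ, ContDiff ℝ ∞ ψ → HasCompactSupport ψ → T ψ →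
      (∫ x, ((Ω x + δ x) + 1 / 2 * x * (Ω₁ x + δ₁ x)
          + a * (∫ s in (0 : ℝ)..x, hilbertTransform (fun y => Ω y + δ y) s) * (Ω₁ x + δ₁ x)
          - hilbertTransform (fun y => Ω y + δ y) x * (Ω x + δ x)) * ψ x) + ν * ∫ x, (Ω₁ x + δ₁ x) * deriv ψ x = 0 := by
  intro ψ hψ hψc hT
  rw [weakPairing_add_of_primitive hΩ hΩ₁ hΩi hΩ2 hδ hδ₁ hδi hδ2 hψ hψc, hlin ψ hψ hψc hT]
  ring

end SheetRWeakPairingExpansion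
end Summit.NavierStokesRegularity.OSWSelfSimilar

end
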